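import Mathlib
import Summits.CriticalPhenomena.SAWScalingLimit.Theses.SAWLoopFugacityFlow
import Summits.CriticalPhenomena.SAWScalingLimit.Theses.SAWParafermion
import Literature.Probability.RandomPlanarGeometry.LoewnerDescription

/-!
# Sketch — crux `SimpleSubseqLimits` (stmt-CriticalPhenomena-4982), crux-ideate round 1, ideator 1

First lemmas of the two idea cards (statements only; `sorry` bodies):

* card `capacity-clock-no-plateau`: a Loewner-describable curve class whose range is the range of a
  simple curve from `a` is simple (the half-plane capacity clock of a describable class has no
  plateau; a backtrack along an arc is a plateau);
* card `past-shadowing-costs-halves`: under the Kemppainen–Smirnov condition for the critical SAW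
  family (typed: `SAWParafermion.KSConditionG2`), no subsequential limit ever travels along its own
  past (exact shadowing of a non-trivial stretch has probability zero).
-/

open MeasureTheory Filter Topology Set
open Literature.Probability.RandomPlanarGeometry Literature.Probability.LatticeModels

namespace Summit.CriticalPhenomena.SAWScalingLimit.Cruxes.SimpleSubseqLimits.Sketch

/-- FIRST LEMMA (card `capacity-clock-no-plateau`, deterministic, provable now).
If the curve class `c` is described by the Loewner evolution through a chordal uniformizing map
`φ` of `(D; a, b)` and its range is the range of a SIMPLE curve `J` starting at `a = D.pt 0`, then
`c` is simple. Proof idea: with `h = J⁻¹ ∘ c'` for a representative `c'`, the hull of `c'[0,u]`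
is `J[0, max_{[0,u]} h]`; a decrease of `h` freezes the hull on an interval, contradicting
`hcap = 2t`; so `h` is monotone and `mk c' = mk J`. -/
theorem simple_of_isLoewnerDescribable_of_range_eq
    {D : DobrushinDomain} {φ : ConformalEquiv UpperHalfPlane.upperHalfPlaneSet D.carrier}
    (hφ : D.IsChordalUniformizing φ) {c : CurveClass ℂ} (hc : IsLoewnerDescribable φ c)
    {J : Curve ℂ} (hJ : J.IsSimple) (hJc : (CurveClass.mk J).range = c.range)
    (hJ0 : J.source = D.pt 0) : c ∈ CurveClass.simple := by
  sorry

/-- Elementary form of the same lemma without Loewner theory: a curve that is a monotone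
reparametrisation `J ∘ h` (`h` continuous, monotone, onto) of a simple curve `J` has a simple
class. (Used to conclude once "no backtrack along the arc" is known.) -/
theorem mk_mem_simple_of_eq_comp_monotone {J γ : Curve ℂ} (hJ : J.IsSimple)
    (h : unitInterval → unitInterval) (hcont : Continuous h) (hmono : Monotone h)
    (hsurj : Function.Surjective h) (hγ : ∀ t, γ t = J (h t)) :
    CurveClass.mk γ ∈ CurveClass.simple := by
  sorry

/-- FIRST LEMMA (card `past-shadowing-costs-halves`). Under the Kemppainen–Smirnov condition for
the critical `δℤ²` SAW family (route SAWParafermion's typed item `KSConditionG2`; only its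
near-return instances — unforced INWARD crossings of annuli centred on the past, tip outside the
outer disc — are used), every subsequential weak limit `ν` of the pushed-forward SAW laws gives
mass `0` to curves that travel along their own past: there are no parameters `s ≤ t ≤ t'` with
`γ[t, t'] ⊆ γ({v ≤ s, |γ v - γ s| ≥ ρ})` and `|γ t - γ t'| ≥ η`. Discrete content: an
`ε`-shadowing of a stretch of the past of diameter `η` forces `≍ η/ε` unforced inward crossings
of disjoint annuli centred on the past, each of conditional probability `≤ 1/2`, so
`P_δ(ε-shadowing) ≤ K(η, ρ) · 2^{-c η / ε}` uniformly in `δ`; portmanteau and `ε → 0`. -/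
theorem measure_shadowsPast_eq_zero_of_ksConditionG2
    (hG2 : Summit.CriticalPhenomena.SAWScalingLimit.Theses.SAWParafermion.KSConditionG2)
    (D : DobrushinDomain) (a b : ℝ → Site 2) (hab : SAW.IsEndpointApprox D a b)
    (s : ℕ → ℝ) (ν : Measure (CurveClass ℂ)) (hs : Tendsto s atTop (𝓝[>] 0))
    (hν : IsProbabilityMeasure ν)
    (hlim : ∀ f : BoundedContinuousFunction (CurveClass ℂ) ℝ,
      Tendsto (fun n => ∫ γ, f γ.curve ∂(SAW.law D.carrier (s n) (a (s n)) (b (s n))))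
        atTop (𝓝 (∫ x, f x ∂ν)))
    {η ρ : ℝ} (hη : 0 < η) (hρ : 0 < ρ) :
    ν {c | ∃ γ : Curve ℂ, CurveClass.mk γ = c ∧ ∃ s₀ t t' : unitInterval, s₀ ≤ t ∧ t ≤ t' ∧
        η ≤ dist (γ t) (γ t') ∧
        ∀ u : unitInterval, t ≤ u → u ≤ t' →
          γ u ∈ γ '' {v : unitInterval | v ≤ s₀ ∧ ρ ≤ dist (γ v) (γ s₀)}} = 0 := by
  sorry

/-- How the two halves close the crux (statement-level glue, to be proved in crux-plan):
SHAPE — `ν`-a.e. the range is the range of a simple curve from `a` to `b` in `cl D` meeting `∂D`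
only at `a, b` (from the route's `AvoidanceLimit` at the SET level: laws of the sandwiched
continuum agree with the SLE_{8/3} trace law on the π-system of two-sided attached hulls) — and
ORDER — no travelling along the own past (previous lemma) — give `SimpleSubseqLimits`'s carrier
clause, because a continuous surjection onto a simple arc with no backtrack is a monotone
reparametrisation (`mk_mem_simple_of_eq_comp_monotone`). -/
theorem carrier_of_shape_of_order (D : DobrushinDomain) (ν : Measure (CurveClass ℂ))
    (hshape : ∀ᵐ c ∂ν, ∃ J : Curve ℂ, J.IsSimple ∧ (CurveClass.mk J).range = c.range ∧
      J.source = D.pt 0 ∧ J.target = D.pt 1 ∧ J.range ⊆ closure D.carrier ∧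
      J.range ∩ frontier D.carrier ⊆ {D.pt 0, D.pt 1})
    (hends : ∀ᵐ c ∂ν, c.source = D.pt 0 ∧ c.target = D.pt 1)
    (horder : ∀ η ρ : ℝ, 0 < η → 0 < ρ →
      ν {c | ∃ γ : Curve ℂ, CurveClass.mk γ = c ∧ ∃ s₀ t t' : unitInterval, s₀ ≤ t ∧ t ≤ t' ∧
        η ≤ dist (γ t) (γ t') ∧ ∀ u : unitInterval, t ≤ u → u ≤ t' →
          γ u ∈ γ '' {v : unitInterval | v ≤ s₀ ∧ ρ ≤ dist (γ v) (γ s₀)}} = 0) :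
    ∀ᵐ c ∂ν, c ∈ CurveClass.simple ∧ c.source = D.pt 0 ∧ c.target = D.pt 1 ∧
      c.range ⊆ closure D.carrier ∧ c.range ∩ frontier D.carrier ⊆ {D.pt 0, D.pt 1} := by
  sorry

end Summit.CriticalPhenomena.SAWScalingLimit.Cruxes.SimpleSubseqLimits.Sketch
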